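import Summits.AtomisticToContinuum.Crystallization.Theorems.ChartedZeroExcessLayeredLatticeLiouvilleZZZYRCI

/-!
# Charted zero-excess layered-lattice Liouville — ZZZYRCJ: (PF♯) ⟸ MASS-POS ∧ PLAQ-MASS-POS (PROVED); MASS-POS ⟸ COVERING (PROVED)

Cell `decomp-a2c`, lens 2, generation 99.  Completes the partition-of-unity bookkeeping of the chain of record:

* `partition_hasSum` — the resummation of ZZZYRCI in full generality (arbitrary index types: weights `W c x`, masses `Σᶠ_c W c x`, a
  functional `F` carried by a finite set, centres carried by a finite set, non-zero mass on the support of `F`);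
* `plaqWeight_eq_zero_of_far`, `finite_plaqCarrier`, `nullTerm_eq_zero_of_notMem` — the plaquette-side finiteness (the vertices of a plaquette
  `(y, a, b)` are `y`, `s_a y`, `s_b y`, `s_b s_a y`, `s_a s_b y`; each step `stepIdx d a` is injective);
* ★★ `partitionIdentityFullP_of_massPos : 0 < c₀ → MassPosP s Λ c₀ ℓ₀ (max ϱ r₁) R → PlaqMassPosP s Λ c₀ ℓ₀ r₁ R → PartitionIdentityFullP s Λ
  c₀ ℓ₀ r₁ ϱ R` — (PF♯) of ZZZYRC for ALL `μ ν d Cpar Cperp` (pair masses positive up to `max ϱ r₁` because the contact terms live on `‖e‖ ≤ r₁`;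
  at the dials `r₁ = 9/8 ≤ ϱ = 4` this is just `MassPosP … ϱ R`);
* `PlaqMassPosP` — NEW typed geometric support Prop: every plaquette of a short-step table on an admissible word has positive mass (its vertices lie
  within `2·max(‖gen₁‖, ‖gen₂‖, r₁) ≤ R` of its base point; CELL-ID level like MASS-POS);
* ★ `massPosP_of_covering : 0 < c₀ → 0 < R → rc + ϱ/2 ≤ R → CoveringP s Λ c₀ ℓ₀ rc → MassPosP s Λ c₀ ℓ₀ ϱ R` — MASS-POS from the 3-D COVERING
  RADIUS `CoveringP` (every point of space within `rc` of a site; the same input the tail remainder lemma of memo NODE-g99 §2(c) uses): the site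
  nearest the midpoint of an in-range pair carries it.  At `(ϱ, R) = (4, 3)`: `rc ≤ 1`.

Def + theorem file (2 defs, 9 theorems); imports ZZZYRCI; no instance / notation / option; 0 sorry. [g99]
-/

open scoped BigOperators InnerProductSpace RealInnerProductSpace

namespace Summit.AtomisticToContinuum.Crystallization.Theorems.ChartedZeroExcessLayeredLatticeLiouville

open Summit.AtomisticToContinuum.Crystallization.Theorems.ChartedPlanarOrderRigidityDoor (E3)

/-- **PLAQ-MASS-POS «PlaqMassPosP s Λ c₀ ℓ₀ r₁ R»** — every plaquette of a short-step table on an admissible word has positive cluster mass.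
support · GEOMETRIC (CELL-ID level: `2·max(‖gen₁ L‖, ‖gen₂ L‖, r₁) ≤ R` on clean words). [g99] -/
def PlaqMassPosP (s Λ c₀ ℓ₀ r₁ R : ℝ) : Prop :=
  ∀ a : ℝ, 0 < a → ∀ (L : E3 ≃L[ℝ] E3) (w' : ℤ → E3), IsAdmissibleWord a s Λ c₀ ℓ₀ L w' →
    ∀ d : ℤ → Cell 2, IsShortStep r₁ (gen₁ L) (gen₂ L) w' d →
      ∀ p : (Cell 2 × ℤ) × Fin 3 × Fin 3, 0 < plaqMass R (gen₁ L) (gen₂ L) w' d p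

/-- **COVERING «CoveringP s Λ c₀ ℓ₀ rc»** — the 3-D covering radius of an admissible word is at most `rc`: every point of space lies within `rc`
of a lattice site.  support · GEOMETRIC (CELL-ID level; booked `rc ≤ 0.755`). [g99] -/
def CoveringP (s Λ c₀ ℓ₀ rc : ℝ) : Prop :=
  ∀ a : ℝ, 0 < a → ∀ (L : E3 ≃L[ℝ] E3) (w' : ℤ → E3), IsAdmissibleWord a s Λ c₀ ℓ₀ L w' →
    ∀ P : E3, ∃ Y : Cell 2 × ℤ, ‖lsite (gen₁ L) (gen₂ L) w' Y.1 Y.2 - P‖ ≤ rc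

/-! ### The resummation in general -/

/-- ★ **GENERIC RESUMMATION**: weights `W c x`, masses `Σᶠ_c W c x`; if `F` is carried by the finite set `N`, the centres of the elements of `N`
by the finite set `C`, and the mass is non-zero on the support of `F`, then `HasSum (c ↦ Σᶠ_x (W c x / mass x)·F x) (Σᶠ_x F x)`. [g99] -/
theorem partition_hasSum {ι κ : Type*} (W : κ → ι → ℝ) (F : ι → ℝ) (N : Finset ι) (hFN : ∀ x, F x ≠ 0 → x ∈ N) (C : Finset κ)
    (hWC : ∀ x ∈ N, ∀ cc, W cc x ≠ 0 → cc ∈ C) (hm : ∀ x, F x ≠ 0 → (∑ᶠ cc, W cc x) ≠ 0) :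
    HasSum (fun cc : κ => ∑ᶠ x : ι, W cc x / (∑ᶠ c', W c' x) * F x) (∑ᶠ x : ι, F x) := by
  classical
  have hsuppF : Function.support F ⊆ ↑N := fun x hx => Finset.mem_coe.mpr (hFN x hx)
  have hshare : ∀ cc, (∑ᶠ x : ι, W cc x / (∑ᶠ c', W c' x) * F x) = ∑ x ∈ N, W cc x / (∑ᶠ c', W c' x) * F x := by
    intro cc
    refine finsum_eq_sum_of_support_subset _ fun x hx => ?_
    rw [Function.mem_support] at hx
    refine Finset.mem_coe.mpr (hFN x fun h0 => hx ?_)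
    rw [h0, mul_zero]
  have hoff : ∀ cc ∉ C, (∑ᶠ x : ι, W cc x / (∑ᶠ c', W c' x) * F x) = 0 := by
    intro cc hcc
    rw [hshare cc]
    refine Finset.sum_eq_zero fun x hx => ?_
    have hw0 : W cc x = 0 := by
      by_contra h
      exact hcc (hWC x hx cc h)
    rw [hw0, zero_div, zero_mul]
  have hmass : ∀ x ∈ N, ∑ cc ∈ C, W cc x = ∑ᶠ cc, W cc x := by
    intro x hx
    rw [finsum_eq_sum_of_support_subset _ fun cc hcc => ?_]
    exact Finset.mem_coe.mpr (hWC x hx cc (Function.mem_support.mp hcc))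
  have hsum : ∑ cc ∈ C, (∑ᶠ x : ι, W cc x / (∑ᶠ c', W c' x) * F x) = ∑ᶠ x : ι, F x := by
    rw [finsum_eq_sum_of_support_subset _ hsuppF]
    simp_rw [hshare]
    rw [Finset.sum_comm]
    refine Finset.sum_congr rfl fun x hx => ?_
    have h1 : ∑ cc ∈ C, W cc x / (∑ᶠ c', W c' x) * F x = (∑ cc ∈ C, W cc x) / (∑ᶠ c', W c' x) * F x := by
      rw [Finset.sum_div, Finset.sum_mul]
    rw [h1, hmass x hx]
    by_cases hFx : F x = 0
    · rw [hFx, mul_zero]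
    · rw [div_self (hm x hFx), one_mul]
  rw [← hsum]
  exact hasSum_sum_of_ne_finset_zero hoff

/-! ### Plaquette-side finiteness -/

/-- `stepIdx_injective` (auxiliary). [g99; docstring added in hand-2 g47 lane edition ed1] -/
theorem stepIdx_injective (d : ℤ → Cell 2) (a : Fin 3) : Function.Injective (stepIdx d a) := by
  intro x y h
  unfold stepIdx at h
  by_cases h0 : a = 0
  · simp only [h0, if_true] at h
    have h1 := congrArg Prod.fst h
    have h2 := congrArg Prod.snd h
    simp only [add_left_inj] at h1
    exact Prod.ext h1 h2
  · by_cases h1 : a = 1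
    · have h10 : (1 : Fin 3) ≠ 0 := by decide
      simp only [h1, h10, if_false, if_true] at h
      have h3 := congrArg Prod.fst h
      have h4 := congrArg Prod.snd h
      simp only [add_left_inj] at h3
      exact Prod.ext h3 h4
    · simp only [h0, h1, if_false] at h
      have h3 := congrArg Prod.fst h
      have h4 := congrArg Prod.snd h
      simp only [add_left_inj] at h4
      simp only [h4, add_left_inj] at h3
      exact Prod.ext h3 h4

/-- the centres carrying a plaquette lie within `R` of its base point. [g99] -/
theorem plaqWeight_eq_zero_of_far {R : ℝ} (a b : E3) (w : ℤ → E3) (d : ℤ → Cell 2) (c : Cell 2 × ℤ) (p : (Cell 2 × ℤ) × Fin 3 × Fin 3)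
    (h : ¬‖lsite a b w c.1 c.2 - lsite a b w p.1.1 p.1.2‖ ≤ R) : plaqWeight R a b w d c p = 0 := by
  have h' : ¬‖lsite a b w p.1.1 p.1.2 - lsite a b w c.1 c.2‖ ≤ R := by rwa [norm_sub_rev]
  simp only [plaqWeight, siteWeight, if_neg h', zero_mul]

/-- the base points of the plaquettes seen by a test field supported in `S` form a finite set. [g99] -/
theorem finite_plaqCarrier (d : ℤ → Cell 2) (S : Finset (Cell 2 × ℤ)) :
    {y : Cell 2 × ℤ | y ∈ S ∨ (∃ a, stepIdx d a y ∈ S) ∨ ∃ a b, stepIdx d a (stepIdx d b y) ∈ S}.Finite := by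
  have hS : (↑S : Set (Cell 2 × ℤ)).Finite := S.finite_toSet
  have h1 : ∀ a, {y : Cell 2 × ℤ | stepIdx d a y ∈ S}.Finite := fun a =>
    (hS.preimage (stepIdx_injective d a).injOn)
  have h2 : ∀ a b, {y : Cell 2 × ℤ | stepIdx d a (stepIdx d b y) ∈ S}.Finite := fun a b =>
    (hS.preimage ((stepIdx_injective d a).comp (stepIdx_injective d b)).injOn)
  refine ((hS.union (Set.finite_iUnion h1)).union (Set.finite_iUnion fun a => Set.finite_iUnion (h2 a))).subset ?_
  rintro y (hy | ⟨a, ha⟩ | ⟨a, b, hab⟩)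
  · exact Or.inl (Or.inl hy)
  · exact Or.inl (Or.inr (Set.mem_iUnion.mpr ⟨a, ha⟩))
  · exact Or.inr (Set.mem_iUnion.mpr ⟨a, Set.mem_iUnion.mpr ⟨b, hab⟩⟩)

/-- a plaquette term off the carrier vanishes. [g99] -/
theorem nullTerm_eq_zero_of_notMem {φ : Cell 2 → ℤ → E3} {S : Finset (Cell 2 × ℤ)} (hS : ∀ γ m, (γ, m) ∉ S → φ γ m = 0)
    (d : ℤ → Cell 2) (Cpar : ℤ → Fin 3 → Fin 3 → (E3 →L[ℝ] E3)) (Cperp : Fin 3 → Fin 3 → (E3 →L[ℝ] E3))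
    (p : (Cell 2 × ℤ) × Fin 3 × Fin 3)
    (hp : ¬(p.1 ∈ S ∨ (∃ a, stepIdx d a p.1 ∈ S) ∨ ∃ a b, stepIdx d a (stepIdx d b p.1) ∈ S)) :
    nullTerm d Cpar Cperp φ p = 0 := by
  have h0 : φ p.1.1 p.1.2 = 0 := hS _ _ fun h => hp (Or.inl h)
  have h1 : ∀ a, φ (stepIdx d a p.1).1 (stepIdx d a p.1).2 = 0 := fun a => hS _ _ fun h => hp (Or.inr (Or.inl ⟨a, h⟩))
  have h2 : ∀ a b, φ (stepIdx d a (stepIdx d b p.1)).1 (stepIdx d a (stepIdx d b p.1)).2 = 0 := fun a b =>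
    hS _ _ fun h => hp (Or.inr (Or.inr ⟨a, b, h⟩))
  simp only [nullTerm, h0, h1, h2, sub_zero, inner_zero_left]

/-! ### (PF♯) from the mass positivities -/

/-- ★★ **(PF♯) ⟸ MASS-POS ∧ PLAQ-MASS-POS (PROVED)**: the cluster partition of unity resums the full-range cluster forms to
`rangeHessSum ϱ − μ·S₁ + ν·N₁ + nullTotal`, for ALL `μ ν d Cpar Cperp` — the `hPU` hypothesis of every door of the chain. [g99] -/
theorem partitionIdentityFullP_of_massPos {s Λ c₀ ℓ₀ r₁ ϱ R : ℝ} (hc₀ : 0 < c₀) (hM : MassPosP s Λ c₀ ℓ₀ (max ϱ r₁) R)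
    (hQ : PlaqMassPosP s Λ c₀ ℓ₀ r₁ R) : PartitionIdentityFullP s Λ c₀ ℓ₀ r₁ ϱ R := by
  intro a ha L w' hA φ hφ μ ν d Cpar Cperp hd
  classical
  obtain ⟨S, hS⟩ := hφ
  have hw : IsLayeredCrystal c₀ (gen₁ L) (gen₂ L) w' := hA.2.2.2.1
  -- the pair functional and its carrier
  set F : (Cell 2 × ℤ) × (Cell 2 × ℤ) → ℝ := fun x =>
    (if 0 < ‖bondVec (gen₁ L) (gen₂ L) w' x‖ ∧ ‖bondVec (gen₁ L) (gen₂ L) w' x‖ ≤ ϱ then pairHess (gen₁ L) (gen₂ L) w' φ x else 0)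
      + (if 0 < ‖bondVec (gen₁ L) (gen₂ L) w' x‖ ∧ ‖bondVec (gen₁ L) (gen₂ L) w' x‖ ≤ r₁ then
          ν * ‖φ x.2.1 x.2.2 - φ x.1.1 x.1.2‖ ^ 2 - μ * sqStretch (gen₁ L) (gen₂ L) w' φ x else 0) with hF_def
  set N := (finite_nearPairs hc₀ hw S (max ϱ r₁)).toFinset with hN_def
  have hΔ : ∀ x : (Cell 2 × ℤ) × (Cell 2 × ℤ), ¬(x.1 ∈ S ∨ x.2 ∈ S) → φ x.2.1 x.2.2 - φ x.1.1 x.1.2 = 0 := fun x hor =>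
    diff_eq_zero_of_notMem hS x (not_or.mp hor).1 (not_or.mp hor).2
  have hF1N : ∀ x, (if 0 < ‖bondVec (gen₁ L) (gen₂ L) w' x‖ ∧ ‖bondVec (gen₁ L) (gen₂ L) w' x‖ ≤ ϱ then
      pairHess (gen₁ L) (gen₂ L) w' φ x else 0) ≠ 0 → x ∈ N := by
    intro x hx
    rw [hN_def, Set.Finite.mem_toFinset]
    by_cases h : 0 < ‖bondVec (gen₁ L) (gen₂ L) w' x‖ ∧ ‖bondVec (gen₁ L) (gen₂ L) w' x‖ ≤ ϱ
    · refine ⟨h.2.trans (le_max_left _ _), ?_⟩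
      by_contra hor
      apply hx
      simp only [if_pos h, pairHess, hΔ x hor, inner_zero_left]
    · exact absurd (by simp only [if_neg h]) hx
  have hF2N : ∀ x, (if 0 < ‖bondVec (gen₁ L) (gen₂ L) w' x‖ ∧ ‖bondVec (gen₁ L) (gen₂ L) w' x‖ ≤ r₁ then
      ν * ‖φ x.2.1 x.2.2 - φ x.1.1 x.1.2‖ ^ 2 - μ * sqStretch (gen₁ L) (gen₂ L) w' φ x else 0) ≠ 0 → x ∈ N := by
    intro x hx
    rw [hN_def, Set.Finite.mem_toFinset]
    by_cases h : 0 < ‖bondVec (gen₁ L) (gen₂ L) w' x‖ ∧ ‖bondVec (gen₁ L) (gen₂ L) w' x‖ ≤ r₁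
    · refine ⟨h.2.trans (le_max_right _ _), ?_⟩
      by_contra hor
      apply hx
      simp only [if_pos h, sqStretch, hΔ x hor, inner_zero_right, norm_zero]
      simp
    · exact absurd (by simp only [if_neg h]) hx
  have hFN : ∀ x, F x ≠ 0 → x ∈ N := by
    intro x hx
    by_contra hxN
    apply hx
    have h1 := not_imp_comm.mp (hF1N x) hxN
    have h2 := not_imp_comm.mp (hF2N x) hxN
    simp only [hF_def]
    rw [h1, h2, add_zero]
  -- pair masses
  have hm : ∀ x, F x ≠ 0 → (∑ᶠ cc, pairWeight R (gen₁ L) (gen₂ L) w' cc x) ≠ 0 := by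
    intro x hx
    have hx' : 0 < ‖bondVec (gen₁ L) (gen₂ L) w' x‖ ∧ ‖bondVec (gen₁ L) (gen₂ L) w' x‖ ≤ max ϱ r₁ := by
      by_contra hno
      apply hx
      have h1 : ¬(0 < ‖bondVec (gen₁ L) (gen₂ L) w' x‖ ∧ ‖bondVec (gen₁ L) (gen₂ L) w' x‖ ≤ ϱ) := fun h =>
        hno ⟨h.1, h.2.trans (le_max_left _ _)⟩
      have h2 : ¬(0 < ‖bondVec (gen₁ L) (gen₂ L) w' x‖ ∧ ‖bondVec (gen₁ L) (gen₂ L) w' x‖ ≤ r₁) := fun h =>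
        hno ⟨h.1, h.2.trans (le_max_right _ _)⟩
      simp only [hF_def, if_neg h1, if_neg h2, add_zero]
    exact (hM a ha L w' hA x hx'.1 hx'.2).ne'
  -- centres of pairs
  set C : Finset (Cell 2 × ℤ) := N.biUnion fun x => (finite_near_lsite hc₀ hw x.1 R).toFinset with hC_def
  have hWC : ∀ x ∈ N, ∀ cc, pairWeight R (gen₁ L) (gen₂ L) w' cc x ≠ 0 → cc ∈ C := by
    intro x hx cc hcc
    rw [hC_def, Finset.mem_biUnion]
    refine ⟨x, hx, ?_⟩
    rw [Set.Finite.mem_toFinset]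
    by_contra h
    exact hcc (pairWeight_eq_zero_of_far _ _ _ cc x h)
  have hpairs := partition_hasSum (fun cc x => pairWeight R (gen₁ L) (gen₂ L) w' cc x) F N hFN C hWC hm
  -- plaquettes
  set G : (Cell 2 × ℤ) × Fin 3 × Fin 3 → ℝ := fun p => nullTerm d Cpar Cperp φ p with hG_def
  set V := (finite_plaqCarrier d S).toFinset with hV_def
  set NQ : Finset ((Cell 2 × ℤ) × Fin 3 × Fin 3) := V ×ˢ Finset.univ with hNQ_def
  have hGN : ∀ p, G p ≠ 0 → p ∈ NQ := by
    intro p hp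
    rw [hNQ_def, Finset.mem_product]
    refine ⟨?_, Finset.mem_univ _⟩
    rw [hV_def, Set.Finite.mem_toFinset]
    by_contra h
    exact hp (nullTerm_eq_zero_of_notMem hS d Cpar Cperp p h)
  have hmQ : ∀ p, G p ≠ 0 → (∑ᶠ cc, plaqWeight R (gen₁ L) (gen₂ L) w' d cc p) ≠ 0 := fun p _ =>
    (hQ a ha L w' hA d hd p).ne'
  set CQ : Finset (Cell 2 × ℤ) := NQ.biUnion fun p => (finite_near_lsite hc₀ hw p.1 R).toFinset with hCQ_def
  have hWCQ : ∀ p ∈ NQ, ∀ cc, plaqWeight R (gen₁ L) (gen₂ L) w' d cc p ≠ 0 → cc ∈ CQ := by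
    intro p hp cc hcc
    rw [hCQ_def, Finset.mem_biUnion]
    refine ⟨p, hp, ?_⟩
    rw [Set.Finite.mem_toFinset]
    by_contra h
    exact hcc (plaqWeight_eq_zero_of_far _ _ _ d cc p h)
  have hplaqs := partition_hasSum (fun cc p => plaqWeight R (gen₁ L) (gen₂ L) w' d cc p) G NQ hGN CQ hWCQ hmQ
  -- the value of the pair resummation
  have hsuppF : Function.support F ⊆ ↑N := fun x hx => Finset.mem_coe.mpr (hFN x hx)
  have hsupp1 : Function.support (fun x => if 0 < ‖bondVec (gen₁ L) (gen₂ L) w' x‖ ∧ ‖bondVec (gen₁ L) (gen₂ L) w' x‖ ≤ ϱ then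
      pairHess (gen₁ L) (gen₂ L) w' φ x else 0) ⊆ ↑N := fun x hx => Finset.mem_coe.mpr (hF1N x hx)
  have hsuppS : Function.support (fun x : (Cell 2 × ℤ) × (Cell 2 × ℤ) =>
      if 0 < ‖bondVec (gen₁ L) (gen₂ L) w' x‖ ∧ ‖bondVec (gen₁ L) (gen₂ L) w' x‖ ≤ r₁ then
        ⟪bondVec (gen₁ L) (gen₂ L) w' x, φ x.2.1 x.2.2 - φ x.1.1 x.1.2⟫ ^ 2 / ‖bondVec (gen₁ L) (gen₂ L) w' x‖ ^ 2 else 0) ⊆ ↑N := by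
    intro x hx
    rw [Function.mem_support] at hx
    refine Finset.mem_coe.mpr ?_
    rw [hN_def, Set.Finite.mem_toFinset]
    by_cases h : 0 < ‖bondVec (gen₁ L) (gen₂ L) w' x‖ ∧ ‖bondVec (gen₁ L) (gen₂ L) w' x‖ ≤ r₁
    · refine ⟨h.2.trans (le_max_right _ _), ?_⟩
      by_contra hor
      apply hx
      simp only [if_pos h, hΔ x hor, inner_zero_right]
      simp
    · exact absurd (by simp only [if_neg h]) hx
  have hsuppC : Function.support (fun x : (Cell 2 × ℤ) × (Cell 2 × ℤ) =>
      if 0 < ‖bondVec (gen₁ L) (gen₂ L) w' x‖ ∧ ‖bondVec (gen₁ L) (gen₂ L) w' x‖ ≤ r₁ then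
        ‖φ x.2.1 x.2.2 - φ x.1.1 x.1.2‖ ^ 2 else 0) ⊆ ↑N := by
    intro x hx
    rw [Function.mem_support] at hx
    refine Finset.mem_coe.mpr ?_
    rw [hN_def, Set.Finite.mem_toFinset]
    by_cases h : 0 < ‖bondVec (gen₁ L) (gen₂ L) w' x‖ ∧ ‖bondVec (gen₁ L) (gen₂ L) w' x‖ ≤ r₁
    · refine ⟨h.2.trans (le_max_right _ _), ?_⟩
      by_contra hor
      apply hx
      simp only [if_pos h, hΔ x hor, norm_zero]
      simp
    · exact absurd (by simp only [if_neg h]) hx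
  have hval : (∑ᶠ x, F x) = rangeHessSum ϱ (gen₁ L) (gen₂ L) w' φ - μ * stretchForm 0 r₁ (gen₁ L) (gen₂ L) w' φ
      + ν * contactForm r₁ (gen₁ L) (gen₂ L) w' φ := by
    unfold rangeHessSum stretchForm contactForm
    rw [finsum_eq_sum_of_support_subset _ hsuppF, finsum_eq_sum_of_support_subset _ hsupp1,
      finsum_eq_sum_of_support_subset _ hsuppS, finsum_eq_sum_of_support_subset _ hsuppC, Finset.mul_sum, Finset.mul_sum,
      ← Finset.sum_sub_distrib, ← Finset.sum_add_distrib]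
    refine Finset.sum_congr rfl fun x _ => ?_
    simp only [hF_def, sqStretch]
    split_ifs <;> ring
  -- assemble
  have htot := hpairs.add hplaqs
  rw [hval] at htot
  exact htot

/-! ### MASS-POS from the covering radius -/

/-- `clusterBump_pos` (auxiliary). [g99; docstring added in hand-2 g47 lane edition ed1] -/
theorem clusterBump_pos {t : ℝ} (h0 : 0 ≤ t) (h1 : t ≤ 1) : 0 < clusterBump t := by
  unfold clusterBump
  have h2 : (20 * t / 23) ^ 2 < 1 := by
    have h3 : 0 ≤ 20 * t / 23 := by positivity
    have h4 : 20 * t / 23 < 1 := by linarith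
    calc (20 * t / 23) ^ 2 < 1 ^ 2 := pow_lt_pow_left₀ h4 h3 two_ne_zero
      _ = 1 := one_pow 2
  have h5 : 0 < 1 - (20 * t / 23) ^ 2 := by linarith
  positivity

/-- `siteWeight_nonneg` (auxiliary). [g99; docstring added in hand-2 g47 lane edition ed1] -/
theorem siteWeight_nonneg (R : ℝ) (a b : E3) (w : ℤ → E3) (c p : Cell 2 × ℤ) : 0 ≤ siteWeight R a b w c p := by
  unfold siteWeight clusterBump
  split_ifs
  · positivity
  · exact le_rfl

/-- `siteWeight_pos` (auxiliary). [g99; docstring added in hand-2 g47 lane edition ed1] -/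
theorem siteWeight_pos {R : ℝ} (hR : 0 < R) (a b : E3) (w : ℤ → E3) (c p : Cell 2 × ℤ)
    (h : ‖lsite a b w p.1 p.2 - lsite a b w c.1 c.2‖ ≤ R) : 0 < siteWeight R a b w c p := by
  unfold siteWeight
  rw [if_pos h]
  exact clusterBump_pos (div_nonneg (norm_nonneg _) hR.le) ((div_le_one hR).mpr h)

/-- ★ **MASS-POS ⟸ COVERING (PROVED)**: if every point of space is within `rc` of a site and `rc + ϱ/2 ≤ R`, every in-range pair has positive
mass — the site nearest its midpoint lies within `R` of both endpoints. [g99] -/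
theorem massPosP_of_covering {s Λ c₀ ℓ₀ ϱ R rc : ℝ} (hc₀ : 0 < c₀) (hR : 0 < R) (hϱ : rc + ϱ / 2 ≤ R) (hcov : CoveringP s Λ c₀ ℓ₀ rc) :
    MassPosP s Λ c₀ ℓ₀ ϱ R := by
  intro a ha L w' hA x _ hx
  classical
  have hw : IsLayeredCrystal c₀ (gen₁ L) (gen₂ L) w' := hA.2.2.2.1
  set P1 := lsite (gen₁ L) (gen₂ L) w' x.1.1 x.1.2 with hP1
  set P2 := lsite (gen₁ L) (gen₂ L) w' x.2.1 x.2.2 with hP2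
  obtain ⟨Y, hY⟩ := hcov a ha L w' hA ((2 : ℝ)⁻¹ • (P1 + P2))
  set Q := lsite (gen₁ L) (gen₂ L) w' Y.1 Y.2 with hQ
  have he : ‖P2 - P1‖ ≤ ϱ := by simpa [bondVec, hP1, hP2] using hx
  have h1 : ‖P1 - Q‖ ≤ R := by
    have hdec : P1 - Q = (2 : ℝ)⁻¹ • (P1 - P2) - (Q - (2 : ℝ)⁻¹ • (P1 + P2)) := by module
    calc ‖P1 - Q‖ = ‖(2 : ℝ)⁻¹ • (P1 - P2) - (Q - (2 : ℝ)⁻¹ • (P1 + P2))‖ := by rw [hdec]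
      _ ≤ ‖(2 : ℝ)⁻¹ • (P1 - P2)‖ + ‖Q - (2 : ℝ)⁻¹ • (P1 + P2)‖ := norm_sub_le _ _
      _ = 2⁻¹ * ‖P2 - P1‖ + ‖Q - (2 : ℝ)⁻¹ • (P1 + P2)‖ := by
          rw [norm_smul, norm_inv, Real.norm_two, norm_sub_rev P1 P2]
      _ ≤ 2⁻¹ * ϱ + rc := add_le_add (by gcongr) hY
      _ ≤ R := by linarith
  have h2 : ‖P2 - Q‖ ≤ R := by
    have hdec : P2 - Q = (2 : ℝ)⁻¹ • (P2 - P1) - (Q - (2 : ℝ)⁻¹ • (P1 + P2)) := by module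
    calc ‖P2 - Q‖ = ‖(2 : ℝ)⁻¹ • (P2 - P1) - (Q - (2 : ℝ)⁻¹ • (P1 + P2))‖ := by rw [hdec]
      _ ≤ ‖(2 : ℝ)⁻¹ • (P2 - P1)‖ + ‖Q - (2 : ℝ)⁻¹ • (P1 + P2)‖ := norm_sub_le _ _
      _ = 2⁻¹ * ‖P2 - P1‖ + ‖Q - (2 : ℝ)⁻¹ • (P1 + P2)‖ := by rw [norm_smul, norm_inv, Real.norm_two]
      _ ≤ 2⁻¹ * ϱ + rc := add_le_add (by gcongr) hY
      _ ≤ R := by linarith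
  have hwY : 0 < pairWeight R (gen₁ L) (gen₂ L) w' Y x :=
    mul_pos (siteWeight_pos hR _ _ _ Y x.1 h1) (siteWeight_pos hR _ _ _ Y x.2 h2)
  -- the mass is a finite sum of non-negative weights containing the `Y` term
  set C := (finite_near_lsite hc₀ hw x.1 R).toFinset with hC_def
  have hsupp : Function.support (fun cc => pairWeight R (gen₁ L) (gen₂ L) w' cc x) ⊆ ↑C := by
    intro cc hcc
    rw [Function.mem_support] at hcc
    refine Finset.mem_coe.mpr ?_
    rw [hC_def, Set.Finite.mem_toFinset]
    by_contra h
    exact hcc (pairWeight_eq_zero_of_far _ _ _ cc x h)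
  have hYC : Y ∈ C := by
    by_contra h
    exact hwY.ne' (Function.notMem_support.mp fun hh => h (Finset.mem_coe.mp (hsupp hh)))
  unfold pairMass
  rw [finsum_eq_sum_of_support_subset _ hsupp]
  exact lt_of_lt_of_le hwY (Finset.single_le_sum (f := fun cc => pairWeight R (gen₁ L) (gen₂ L) w' cc x)
    (fun cc _ => mul_nonneg (siteWeight_nonneg _ _ _ _ _ _) (siteWeight_nonneg _ _ _ _ _ _)) hYC)

end Summit.AtomisticToContinuum.Crystallization.Theorems.ChartedZeroExcessLayeredLatticeLiouville
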